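import Summits.BirchSwinnertonDyer.BirchSwinnertonDyer.Theorems.ManinLocalTwoThreeLatticeOptimalOfModularDegree
import Summits.BirchSwinnertonDyer.BirchSwinnertonDyer.Theorems.ManinLocalTwoThreeMazurManinConstantOddPrimes
import Summits.BirchSwinnertonDyer.BirchSwinnertonDyer.Theorems.ManinLocalTwoThreeStevensNaturalTes75
import Literature.NumberTheory.Automorphic.ShimuraCurveRibetTakahashiOptimalProofs
import Literature.NumberTheory.EllipticCurves.ManinConstantModularDegree
import Literature.NumberTheory.EllipticCurves.ManinConstantDeuringTwistProofs
import HarnessLib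

/-!
# The Manin constant divides the modular degree, prime by prime, for EVERY parametrisation (Česnavičius–Neururer–Saha
# Thm. 1.2 as typed) — unconditionally at every odd prime, and at `p = 2` modulo modularity — from Stevens' inclusion

Route `EdixhovenFibreFiveSeven` (cell `pub/bsd-wall`, seat `bsd-line-edix-p1` g43), `--supports` the PUB bundle
`PublishedManinFacts` (stmt-BirchSwinnertonDyer-22230), whose seventh and last cite-only conjunct is
`cesnaviciusNeururerSaha_padicVal_maninConstant_le_modularDegree` (ČNS 2024 Thm. 1.2, row "`0` otherwise": for every globally
minimal `W/ℚ`, EVERY datum `D` at the conductor level — optimal or not — and every prime `p` off two exceptional clauses,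
`v_p(c) ≤ v_p(deg φ)`).  For LATTICE-OPTIMAL data this is trivial from `p ∤ c₀` (`p ≥ 3`, tree); the content is the non-optimal
data `(W', c', deg')`, where `c'` may be large.

THE ROAD (lattice algebra over the tree; no integral models of `X₀(N)`).  Let `D'` be a datum of `W'` at level `N` with newform `f`,
`Λ' = Λ_{W'} ⊇ c'Λ_f`, and `(W₀, D₀)` the lattice-optimal datum of the class (`Λ_{W₀} = c₀Λ_f`, Edixhoven's integrality — tree).
1. DEGREE MULTIPLICATIVITY WITH ITS INDEX (§1, sharpening the tree's `exists_modularDegree_eq_mul_of_latticeOptimal`):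
   `deg D' = #A · deg D₀` where `A = ψ(Λ') ≤ W₀(ℂ)`, `ψ(z) = unif_{W₀}((c₀/c')·z)` — a generic `φ_{D'}`-fibre is the translate
   `P₀ + A` of the finite group `A ≅ Λ'/c'Λ_f` (the tree's proof, with the target set identified).
2. ORDERS (§2): if `z ∈ Λ' ∩ Λ_f` is `p`-PRIMITIVE in `Λ_f` (`z ∉ pΛ_f`) and `p^m ∣ c'`, the element `ψ(z) ∈ A` has order divisible
   by `p^m` (`n·ψ(z) = 0 ⟺ nz ∈ c'Λ_f ⊆ p^mΛ_f`; coordinates in `Λ_{W₀} ≅ ℤ²`), so `p^m ∣ #A ∣ deg D'` (Lagrange).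
3. THE PRIMITIVE VECTOR is supplied by STEVENS' INCLUSION `Λ₁(f) ⊆ Λ_{W'}` (`periodLatticeGamma1_le_neron`, UDC-dependent tree
   theorem) together with `Λ₁(f) ⊄ pΛ_f`: for `p ≥ 3` the conjugation obstruction
   (`KummerValues.not_periodLatticeGamma1_le_natCast_mul_periodLattice`, fact-free at the optimal datum); for `p = 2` the
   half-index exclusion `NaturalTes75.not_prime_le_of_modularity_naturalTes75` (Kummer–diamond reciprocity + the Frey-twist
   `2`-adic law, which needs level = conductor, i.e. MODULARITY as typed).

RESULTS.
* `padicValInt_maninConstant_le_modularDegree_of_three_le` — `v_p(c) ≤ v_p(deg)` for EVERY datum at EVERY level, every prime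
  `p ≥ 3`, UNCONDITIONALLY (UDC-dependent): ČNS's row at `p ≥ 5`, and MORE than print at `p = 3` (no `27 ∣ N` exception).
* `padicValInt_maninConstant_le_modularDegree_of_modularity` — the same at every prime, modulo `exists_isNewformOf`; hence
  `cesnaviciusNeururerSaha_padicVal_maninConstant_le_modularDegree_of_modularity` and `cesnaviciusNeururerSaha_thm_1_2_of_modularity`
  (the typed ČNS facts, with NO exceptional clause used, ⟸ modularity).

HONEST STATUS.  UDC-dependent (Stevens' inclusion, `p ∤ c₀`), audit (P†) pending; the `p = 2` row is CONDITIONAL on the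
Modularity theorem as typed.  Item 22230 stays OPEN as filed (its ČNS conjunct at `p = 2` is asserted outright).  Nothing here
is an integral-model statement about `X₀(N)`; ČNS's theorem is NOT formalised — its typed `Γ₀(N)` rendering is derived by
another road.  BSD is proved for no curve; Manin's conjecture is not announced.
[cite: CesnaviciusNeururerSaha2023, Thm. 1.2] [cite: Stevens1989, §2] [cite: CalegariDimitrovTang2025, Thm. 1.0.1]
[cite: Knapp1993, Prop. 12.9(a)]
-/

set_option autoImplicit false
-- the Theorems namespace of this sub repeats the summit name by design (D-0017 nested layout)
set_option linter.dupNamespace false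

noncomputable section

open scoped Classical MatrixGroups ModularForm

open CongruenceSubgroup UpperHalfPlane WeierstrassCurve Literature.NumberTheory.EllipticCurves
  Literature.NumberTheory.EllipticCurves.ModularForms

namespace Summit.BirchSwinnertonDyer.BirchSwinnertonDyer.Theorems

namespace ManinDividesDegree

open ManinLocalTwoThree

variable {W : WeierstrassCurve ℚ} {N : ℕ} [NeZero N]

/-! ### §1 Degree multiplicativity with its index -/

/-- **Degree multiplicativity with the index identified.**  For `D` lattice-optimal (`Λ_W = cΛ_f`) and `D'` a datum of any
model `W'` at the same level with the same newform: `deg D' = #ψ(Λ_{W'}) · deg D`, where `ψ(z) = unif_W((c/c')·z)` and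
`ψ(Λ_{W'}) ≤ W(ℂ)` is the (finite) image group — a generic `φ_{D'}`-fibre is the disjoint union of the generic `φ_D`-fibres over
the translate `unif_W(c z'/c') + ψ(Λ_{W'})` (the tree's `exists_modularDegree_eq_mul_of_latticeOptimal`, target set made explicit).
[cite: Knapp1993, Prop. 12.9(a) and p. 302] -/
theorem modularDegree_eq_natCard_mul_of_latticeOptimal (D : ModularParametrizationData W N)
    (hL : ∀ z ∈ D.L.lattice, ∃ w ∈ periodLattice D.f, z = D.c * w)
    {W' : WeierstrassCurve ℚ} (D' : ModularParametrizationData W' N) (hf : D'.f = D.f) :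
    D'.modularDegree =
      Nat.card ((D'.L.lattice.toAddSubgroup).map
        (D.uniformize.comp (AddMonoidHom.mulLeft ((D.c : ℂ) / (D'.c : ℂ))))) * D.modularDegree := by
  classical
  -- the comparison homomorphism and its image
  set ψ : ℂ →+ (W.baseChange ℂ).toAffine.Point :=
    D.uniformize.comp (AddMonoidHom.mulLeft ((D.c : ℂ) / (D'.c : ℂ))) with hψdef
  set A : AddSubgroup (W.baseChange ℂ).toAffine.Point := (D'.L.lattice.toAddSubgroup).map ψ with hAdef
  have hψ : ∀ z : ℂ, ψ z = D.uniformize ((D.c : ℂ) / (D'.c : ℂ) * z) := fun z ↦ rfl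
  have hinv : ∀ {τ τ' : ℍ}, Y0.mk N τ = Y0.mk N τ' → D.φ τ = D.φ τ' := D.φ_eq_of_mk_eq_mk_holds'
  have hc' : (D'.c : ℂ) ≠ 0 := by exact_mod_cast D'.maninConstant_ne_zero_holds
  -- the countable set of bad parameters `z'` (verbatim the tree's proof)
  have hS := countable_setOf_fiberOrbitCount_ne D
  haveI : Countable D'.L.lattice := Countable.of_equiv _ D'.L.latticeEquivProd.toEquiv.symm
  have hlat' : (D'.L.lattice : Set ℂ).Countable := Set.countable_coe_iff.mp inferInstance
  have hSbad : (⋃ u ∈ {u : ℂ | D.fiberOrbitCount (D.uniformize ((D.c : ℂ) * u)) ≠ D.modularDegree},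
      (fun l : ℂ => (D'.c : ℂ) * u - l) '' (D'.L.lattice : Set ℂ)).Countable :=
    hS.biUnion fun u _ => hlat'.image _
  have h3 : (D'.uniformize ⁻¹' {P | D'.fiberOrbitCount P ≠ D'.modularDegree}).Countable :=
    countable_preimage_uniformize D' D'.finite_setOf_fiberOrbitCount_ne.countable
  obtain ⟨z', hz'⟩ : ∃ z' : ℂ, z' ∉ (⋃ u ∈ {u : ℂ | D.fiberOrbitCount (D.uniformize ((D.c : ℂ) * u)) ≠ D.modularDegree},
      (fun l : ℂ => (D'.c : ℂ) * u - l) '' (D'.L.lattice : Set ℂ)) ∪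
      D'.uniformize ⁻¹' {P | D'.fiberOrbitCount P ≠ D'.modularDegree} := by
    by_contra h
    exact not_countable_complex ((hSbad.union h3).mono fun z _ => by
      by_contra hz
      exact h ⟨z, hz⟩)
  have good : ∀ u : ℂ, (D'.c : ℂ) * u - z' ∈ D'.L.lattice →
      D.fiberOrbitCount (D.uniformize ((D.c : ℂ) * u)) = D.modularDegree := by
    intro u hu
    by_contra hne
    apply hz'
    refine Or.inl (Set.mem_iUnion₂.mpr ⟨u, hne, (D'.c : ℂ) * u - z', hu, ?_⟩)
    show (D'.c : ℂ) * u - ((D'.c : ℂ) * u - z') = z'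
    ring
  have good' : D'.fiberOrbitCount (D'.uniformize z') = D'.modularDegree := by
    by_contra h
    exact hz' (Or.inr h)
  -- the target points, the fibres
  set T : Set (W.baseChange ℂ).toAffine.Point :=
    {P | ∃ u : ℂ, (D'.c : ℂ) * u - z' ∈ D'.L.lattice ∧ P = D.uniformize ((D.c : ℂ) * u)} with hT
  set F : (W.baseChange ℂ).toAffine.Point → Set (Y0 N) := fun P => {y | ∃ τ : ℍ, Y0.mk N τ = y ∧ D.φ τ = P} with hF
  set F' : Set (Y0 N) := {y | ∃ τ : ℍ, Y0.mk N τ = y ∧ D'.φ τ = D'.uniformize z'} with hF'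
  have hpos : 0 < D.modularDegree := D.deg_pos
  have hpos' : 0 < D'.modularDegree := D'.deg_pos
  have hcard' : F'.ncard = D'.modularDegree := good'
  have hfin' : F'.Finite := Set.finite_of_ncard_ne_zero (by rw [hcard']; exact hpos'.ne')
  have hFcard : ∀ P ∈ T, (F P).ncard = D.modularDegree := by
    rintro P ⟨u, hu, rfl⟩
    exact good u hu
  have hFfin : ∀ P ∈ T, (F P).Finite := fun P hP =>
    Set.finite_of_ncard_ne_zero (by rw [hFcard P hP]; exact hpos.ne')
  have hcover : F' = ⋃ P ∈ T, F P := by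
    ext y
    constructor
    · rintro ⟨τ, hτ, hφ⟩
      have hu : (D'.c : ℂ) * eichlerIntegral D'.f τ - z' ∈ D'.L.lattice := by
        rw [← D'.uniformize_eq_zero_iff, map_sub, sub_eq_zero]
        exact hφ
      refine Set.mem_iUnion₂.mpr ⟨D.uniformize ((D.c : ℂ) * eichlerIntegral D'.f τ), ⟨_, hu, rfl⟩, τ, hτ, ?_⟩
      rw [hf]
      rfl
    · intro hy
      obtain ⟨P, hP, hyP⟩ := Set.mem_iUnion₂.mp hy
      obtain ⟨u, hu, rfl⟩ := hP
      exact fiber_subset_fiber_of_latticeOptimal_of_mem D hL D' hf u z' hu hyP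
  have hTfin : T.Finite := by
    refine (hfin'.image fun y : Y0 N => D.φ (Function.surjInv (Y0.mk_surjective N) y)).subset ?_
    intro P hP
    obtain ⟨hne, -⟩ := Nat.card_ne_zero.mp (by
      rw [Nat.card_coe_set_eq, hFcard P hP]; exact hpos.ne' : Nat.card (F P) ≠ 0)
    obtain ⟨⟨y, τ, hτ, hφ⟩⟩ := hne
    refine ⟨y, ?_, ?_⟩
    · rw [hcover]
      exact Set.mem_iUnion₂.mpr ⟨P, hP, τ, hτ, hφ⟩
    · have hmk : Y0.mk N (Function.surjInv (Y0.mk_surjective N) y) = Y0.mk N τ := by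
        rw [Function.surjInv_eq (Y0.mk_surjective N) y]
        exact hτ.symm
      show D.φ (Function.surjInv (Y0.mk_surjective N) y) = P
      rw [← hφ]
      exact hinv hmk
  have hdisj : T.PairwiseDisjoint F := fun P _ Q _ hPQ => disjoint_fiber_of_ne D hPQ
  have hsum : (⋃ P ∈ T, F P).ncard = ∑ᶠ P ∈ T, (F P).ncard := hTfin.ncard_biUnion hFfin hdisj
  rw [finsum_mem_congr rfl hFcard, finsum_mem_eq_finite_toFinset_sum _ hTfin, Finset.sum_const, smul_eq_mul,
    ← Set.ncard_eq_toFinset_card T hTfin] at hsum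
  -- NEW: the target set is the translate `P₀ + A` of the image group
  have hTA : T = (fun a ↦ ψ z' + a) '' (A : Set (W.baseChange ℂ).toAffine.Point) := by
    ext P
    constructor
    · rintro ⟨u, hu, rfl⟩
      refine ⟨ψ ((D'.c : ℂ) * u - z'), ⟨(D'.c : ℂ) * u - z', hu, rfl⟩, ?_⟩
      show ψ z' + ψ ((D'.c : ℂ) * u - z') = D.uniformize ((D.c : ℂ) * u)
      rw [← map_add, hψ]
      congr 1
      field_simp
      ring
    · rintro ⟨a, ⟨l, hl, rfl⟩, rfl⟩
      refine ⟨(z' + l) / (D'.c : ℂ), ?_, ?_⟩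
      · have e : (D'.c : ℂ) * ((z' + l) / (D'.c : ℂ)) - z' = l := by field_simp; ring
        rw [e]
        exact hl
      · show ψ z' + ψ l = D.uniformize ((D.c : ℂ) * ((z' + l) / (D'.c : ℂ)))
        rw [← map_add, hψ]
        congr 1
        field_simp
  have hTcard : T.ncard = Nat.card A := by
    rw [hTA, Set.ncard_image_of_injective _ (add_right_injective (ψ z')), ← Nat.card_coe_set_eq]
    rfl
  rw [← hTcard, ← hcard', hcover, hsum]

/-! ### §2 Orders in the image group -/

/-- **Coordinates.**  In a period lattice `Λ ≅ ℤ²`: if `X ∈ Λ` is NOT in `pΛ` and `n·X ∈ c'·Λ` with `p^m ∣ c'`, then `p^m ∣ n`.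
[folklore] -/
theorem pow_dvd_of_nsmul_mem_of_not_mem {L : PeriodPair} {p : ℕ} (hp : p.Prime) {m n : ℕ} {c' : ℤ}
    (hc' : (p : ℤ) ^ m ∣ c') {X : ℂ} (hX : X ∈ L.lattice) (hXp : ¬ ∃ V ∈ L.lattice, X = (p : ℂ) * V)
    (hn : ∃ V ∈ L.lattice, (n : ℂ) * X = (c' : ℂ) * V) : p ^ m ∣ n := by
  obtain ⟨V, hV, hnV⟩ := hn
  set e := L.latticeEquivProd with he
  set x : ℤ × ℤ := e ⟨X, hX⟩ with hx
  set v : ℤ × ℤ := e ⟨V, hV⟩ with hv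
  -- `n • x = c' • v` in `ℤ × ℤ`
  have hrel : (n : ℤ) • x = c' • v := by
    have h1 : ((n : ℤ) • (⟨X, hX⟩ : L.lattice)) = c' • (⟨V, hV⟩ : L.lattice) := by
      apply Subtype.ext
      simp only [SetLike.val_smul, zsmul_eq_mul, Int.cast_natCast]
      exact hnV
    rw [hx, hv, ← map_zsmul, ← map_zsmul, h1]
  have ha : (n : ℤ) * x.1 = c' * v.1 := by simpa using congrArg Prod.fst hrel
  have hb : (n : ℤ) * x.2 = c' * v.2 := by simpa using congrArg Prod.snd hrel
  -- `x ∉ p • ℤ²`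
  have hprim : ¬ ((p : ℤ) ∣ x.1 ∧ (p : ℤ) ∣ x.2) := by
    rintro ⟨⟨a₀, ha₀⟩, ⟨b₀, hb₀⟩⟩
    apply hXp
    refine ⟨((e.symm (a₀, b₀) : L.lattice) : ℂ), (e.symm (a₀, b₀)).2, ?_⟩
    have h2 : (⟨X, hX⟩ : L.lattice) = (p : ℤ) • e.symm (a₀, b₀) := by
      apply e.injective
      rw [map_zsmul, LinearEquiv.apply_symm_apply, ← hx]
      ext <;> simp [ha₀, hb₀]
    have h3 := congrArg (fun y : L.lattice ↦ (y : ℂ)) h2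
    simpa [zsmul_eq_mul] using h3
  -- conclude from coprimality (in `ℕ`)
  have hpm : ∀ {a : ℤ}, ¬ (p : ℤ) ∣ a → (p : ℤ) ^ m ∣ (n : ℤ) * a → p ^ m ∣ n := by
    intro a hpa hdvd
    have hpa' : ¬ p ∣ a.natAbs := fun h ↦ hpa (Int.natCast_dvd.mpr h)
    have hdvd' : p ^ m ∣ n * a.natAbs := by
      have h1 := Int.natAbs_dvd_natAbs.mpr hdvd
      simpa [Int.natAbs_mul, Int.natAbs_pow] using h1
    exact (Nat.Coprime.pow_left m ((Nat.Prime.coprime_iff_not_dvd hp).mpr hpa')).dvd_of_dvd_mul_right hdvd'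
  by_cases h1 : (p : ℤ) ∣ x.1
  · have h2 : ¬ (p : ℤ) ∣ x.2 := fun h2 ↦ hprim ⟨h1, h2⟩
    exact hpm h2 (hb ▸ hc'.mul_right v.2)
  · exact hpm h1 (ha ▸ hc'.mul_right v.1)

/-! ### §3 From a `p`-primitive `Γ₁(N)`-period to `v_p(c) ≤ v_p(deg)` -/

/-- **The core inequality.**  Let `W'/ℚ` be globally minimal, `D'` a datum at level `N` (any level), `p` a prime, and suppose some
`Γ₁(N)`-period of the newform is NOT in `pΛ_f` (`Λ₁(f) ⊄ pΛ_f`).  Then `v_p(c(D')) ≤ v_p(deg D')`.  Proof: Stevens' inclusion puts that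
period `z` in `Λ_{W'}`; with the lattice-optimal datum `(W₀, D₀)` of the class (Edixhoven integrality), `deg D' = #A · deg D₀` (§1) and the
order of `ψ(z) ∈ A` is divisible by `p^{v_p(c')}` (§2), hence so is `#A` (Lagrange) and `deg D'`.
[cite: CesnaviciusNeururerSaha2023, Thm. 1.2] [cite: Stevens1989, §2] -/
theorem padicValInt_maninConstant_le_modularDegree_of_gamma1_witness (W' : WeierstrassCurve ℚ) [W'.IsElliptic]
    [W'.IsGloballyMinimal] (D' : ModularParametrizationData W' N) {p : ℕ} (hp : p.Prime)
    (hwit : ∃ z ∈ periodLatticeGamma1 D'.f, ¬ ∃ w ∈ periodLattice D'.f, z = (p : ℂ) * w) :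
    padicValInt p D'.maninConstant ≤ padicValNat p D'.modularDegree := by
  classical
  haveI : Fact p.Prime := ⟨hp⟩
  -- the lattice-optimal datum of the class
  obtain ⟨W₀, hE₀, hM₀, D₀, hf0, -, hopt, -⟩ := D'.exists_optimalDatum_of_edixhoven
    (fun hf' hL' q hq hq' ↦ edixhoven_int_of_neronLattice_eq_smul_periodLattice_holds hf' hL' q hq hq')
  haveI := hE₀
  -- the witness: in `Λ_{W'}` (Stevens) and `p`-primitive in `Λ_f`
  obtain ⟨z, hz1, hzp⟩ := hwit
  have hzΛ' : z ∈ D'.L.lattice := periodLatticeGamma1_le_neron D' z hz1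
  have hzf : z ∈ periodLattice D₀.f := hf0 ▸ periodLatticeGamma1_le_periodLattice D'.f hz1
  have hzp' : ¬ ∃ w ∈ periodLattice D₀.f, z = (p : ℂ) * w := by rw [hf0]; exact hzp
  -- constants
  have hc0 : (D₀.c : ℂ) ≠ 0 := by exact_mod_cast D₀.maninConstant_ne_zero_holds
  have hc' : (D'.c : ℂ) ≠ 0 := by exact_mod_cast D'.maninConstant_ne_zero_holds
  have hc'0 : D'.c ≠ 0 := D'.maninConstant_ne_zero_holds
  -- §1: `deg D' = #A · deg D₀`
  set ψ : ℂ →+ (W₀.baseChange ℂ).toAffine.Point :=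
    D₀.uniformize.comp (AddMonoidHom.mulLeft ((D₀.c : ℂ) / (D'.c : ℂ))) with hψdef
  set A : AddSubgroup (W₀.baseChange ℂ).toAffine.Point := (D'.L.lattice.toAddSubgroup).map ψ with hAdef
  have hψ : ∀ x : ℂ, ψ x = D₀.uniformize ((D₀.c : ℂ) / (D'.c : ℂ) * x) := fun x ↦ rfl
  have hdeg : D'.modularDegree = Nat.card A * D₀.modularDegree :=
    modularDegree_eq_natCard_mul_of_latticeOptimal D₀ hopt D' hf0.symm
  -- §2: the order of `ψ z` is divisible by `p ^ m`, `m = v_p(c')`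
  set m : ℕ := padicValInt p D'.c with hm
  have hpm : (p : ℤ) ^ m ∣ D'.c := (padicValInt_dvd_iff m D'.c).mpr (Or.inr le_rfl)
  have hzA : ψ z ∈ A := AddSubgroup.mem_map_of_mem ψ (by exact hzΛ')
  set n : ℕ := addOrderOf (ψ z) with hn
  have hnA : n ∣ Nat.card A := AddSubgroup.addOrderOf_dvd_natCard A hzA
  have hnz : ∃ w ∈ periodLattice D₀.f, (n : ℂ) * z = (D'.c : ℂ) * w := by
    have h0 : n • ψ z = 0 := addOrderOf_nsmul_eq_zero (ψ z)
    rw [← map_nsmul, hψ, D₀.uniformize_eq_zero_iff] at h0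
    obtain ⟨w, hw, hcw⟩ := hopt _ h0
    refine ⟨w, hw, ?_⟩
    have : (D₀.c : ℂ) / (D'.c : ℂ) * ((n : ℂ) * z) = D₀.c * w := by rw [← hcw, nsmul_eq_mul]
    field_simp at this
    linear_combination this
  -- transport to the Néron lattice `Λ_{W₀} = c₀ Λ_f` and apply §2
  have hX : (D₀.c : ℂ) * z ∈ D₀.L.lattice := D₀.smul_periodLattice_le z hzf
  have hXp : ¬ ∃ V ∈ D₀.L.lattice, (D₀.c : ℂ) * z = (p : ℂ) * V := by
    rintro ⟨V, hV, hXV⟩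
    obtain ⟨w, hw, rfl⟩ := hopt V hV
    exact hzp' ⟨w, hw, mul_left_cancel₀ hc0 (by rw [hXV]; ring)⟩
  have hnX : ∃ V ∈ D₀.L.lattice, (n : ℂ) * ((D₀.c : ℂ) * z) = (D'.c : ℂ) * V := by
    obtain ⟨w, hw, hnw⟩ := hnz
    exact ⟨(D₀.c : ℂ) * w, D₀.smul_periodLattice_le w hw, by rw [← mul_assoc, mul_comm (n : ℂ), mul_assoc, hnw]; ring⟩
  have hpn : p ^ m ∣ n := pow_dvd_of_nsmul_mem_of_not_mem hp hpm hX hXp hnX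
  -- conclude: `p ^ m ∣ deg D'`
  have hdvd : p ^ m ∣ D'.modularDegree := hdeg ▸ (hpn.trans hnA).mul_right _
  have hd0 : D'.modularDegree ≠ 0 := D'.deg_pos.ne'
  simpa [ModularParametrizationData.maninConstant, hm] using (padicValNat_dvd_iff_le hd0).mp hdvd

/-! ### §4 The witnesses: `p ≥ 3` fact-free, `p = 2` from modularity; the typed ČNS facts -/

/-- **`v_p(c) ≤ v_p(deg φ)` for EVERY parametrisation datum at EVERY level and every prime `p ≥ 3` — unconditionally**
(UDC-dependent): the witness `Λ₁(f) ⊄ pΛ_f` is the conjugation obstruction at the lattice-optimal datum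
(`KummerValues.not_periodLatticeGamma1_le_natCast_mul_periodLattice`).  Contains ČNS Thm. 1.2's rows at `p ≥ 5` and
STRENGTHENS its row at `p = 3` (no `27 ∣ N` exception).  [cite: CesnaviciusNeururerSaha2023, Thm. 1.2] [cite: Stevens1989, §2] -/
theorem padicValInt_maninConstant_le_modularDegree_of_three_le (W' : WeierstrassCurve ℚ) [W'.IsElliptic]
    [W'.IsGloballyMinimal] (D' : ModularParametrizationData W' N) {p : ℕ} (hp : p.Prime) (h3 : 3 ≤ p) :
    padicValInt p D'.maninConstant ≤ padicValNat p D'.modularDegree := by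
  obtain ⟨W₀, hE₀, hM₀, D₀, hf0, -, hopt, -⟩ := D'.exists_optimalDatum_of_edixhoven
    (fun hf' hL' q hq hq' ↦ edixhoven_int_of_neronLattice_eq_smul_periodLattice_holds hf' hL' q hq hq')
  haveI := hE₀
  have h := KummerValues.not_periodLatticeGamma1_le_natCast_mul_periodLattice D₀ hopt h3
  push Not at h
  obtain ⟨z, hz, hzp⟩ := h
  rw [hf0] at hz hzp
  exact padicValInt_maninConstant_le_modularDegree_of_gamma1_witness W' D' hp ⟨z, hz, fun ⟨w, hw, e⟩ ↦ hzp w hw e⟩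

/-- **`v_p(c) ≤ v_p(deg φ)` for every datum, every level and EVERY prime, modulo the Modularity theorem** (`exists_isNewformOf`,
used at `p = 2` only: the half-index exclusion `Λ₁(f) ⊄ 2Λ_f` needs level = conductor at the optimal curve).
[cite: CesnaviciusNeururerSaha2023, Thm. 1.2] [cite: Stevens1982, §1.3 Thm. 1.3.1 (b)] [cite: BCDTJAMS2001, Thm. A] -/
theorem padicValInt_maninConstant_le_modularDegree_of_modularity (hnf : exists_isNewformOf) (W' : WeierstrassCurve ℚ)
    [W'.IsElliptic] [W'.IsGloballyMinimal] (D' : ModularParametrizationData W' N) {p : ℕ} (hp : p.Prime) :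
    padicValInt p D'.maninConstant ≤ padicValNat p D'.modularDegree := by
  obtain ⟨W₀, hE₀, hM₀, D₀, hf0, -, hopt, -⟩ := D'.exists_optimalDatum_of_edixhoven
    (fun hf' hL' q hq hq' ↦ edixhoven_int_of_neronLattice_eq_smul_periodLattice_holds hf' hL' q hq hq')
  haveI := hE₀
  have h := NaturalTes75.not_prime_le_of_modularity_naturalTes75 StevensGalois.naturalTes75_holds hnf W₀ D₀ hopt hp
  push Not at h
  obtain ⟨z, hz, hzp⟩ := h
  rw [hf0] at hz hzp
  exact padicValInt_maninConstant_le_modularDegree_of_gamma1_witness W' D' hp ⟨z, hz, fun ⟨w, hw, e⟩ ↦ hzp w hw e⟩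

end ManinDividesDegree

open ManinDividesDegree

/-- **ČNS 2024 Thm. 1.2, row "`0` otherwise", as typed (`cesnaviciusNeururerSaha_padicVal_maninConstant_le_modularDegree`) ⟸ modularity**
— in fact with NEITHER exceptional clause used.  CONDITIONAL on `exists_isNewformOf` (needed at `p = 2` only); UDC-dependent.
[cite: CesnaviciusNeururerSaha2023, Thm. 1.2] [cite: BCDTJAMS2001, Thm. A] -/
theorem cesnaviciusNeururerSaha_padicVal_maninConstant_le_modularDegree_of_modularity (hnf : exists_isNewformOf) :
    cesnaviciusNeururerSaha_padicVal_maninConstant_le_modularDegree :=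
  fun W _ _ _ D _ hp _ _ ↦ padicValInt_maninConstant_le_modularDegree_of_modularity hnf W D hp

/-- **ČNS 2024 Thm. 1.2, full clause, as typed (`cesnaviciusNeururerSaha_thm_1_2`) ⟸ modularity** (the correction term is `≥ 0`;
the bound holds without it).  CONDITIONAL on `exists_isNewformOf`; UDC-dependent. [cite: CesnaviciusNeururerSaha2023, Thm. 1.2] -/
theorem cesnaviciusNeururerSaha_thm_1_2_of_modularity (hnf : exists_isNewformOf) : cesnaviciusNeururerSaha_thm_1_2 :=
  fun W _ _ _ D _ hp ↦ (padicValInt_maninConstant_le_modularDegree_of_modularity hnf W D hp).trans (Nat.le_add_right _ _)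

/-- **The odd-prime part of ČNS Thm. 1.2 as typed, UNCONDITIONALLY** (UDC-dependent): for every globally minimal `W`, every
conductor-level datum and every prime `p ≠ 2` (on or off the printed `p = 3` clause), `v_p(c) ≤ v_p(deg)`.
[cite: CesnaviciusNeururerSaha2023, Thm. 1.2] -/
theorem cesnaviciusNeururerSaha_padicVal_maninConstant_le_modularDegree_odd (W : WeierstrassCurve ℚ) [W.IsElliptic]
    [W.IsGloballyMinimal] [NeZero (W.conductorNorm ℤ)] (D : ModularParametrizationData W (W.conductorNorm ℤ)) {p : ℕ}
    (hp : p.Prime) (hp2 : p ≠ 2) : padicValInt p D.maninConstant ≤ padicValNat p D.modularDegree :=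
  padicValInt_maninConstant_le_modularDegree_of_three_le W D hp
    (by rcases hp.eq_two_or_odd' with h | h <;> [exact absurd h hp2; (obtain ⟨k, hk⟩ := h; have := hp.two_le; omega)])

end Summit.BirchSwinnertonDyer.BirchSwinnertonDyer.Theorems

end
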